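import Summits.BirchSwinnertonDyer.BirchSwinnertonDyer.Theorems.Rank1ResidualX9Defs
import Literature.NumberTheory.EllipticCurves.Rank1Residual.FineMordellWeilCertificates
import HarnessLib
import HarnessLib.Audit

/-!
# FINE MORDELL–WEIL CRITERIA: «certificate ⟹ `Sel₀(ℚ_∞, E[p^∞]) = 0`» at Mordell–Weil rank one (the FMW
# criterion), its rank-zero companion, and the rank-one DICHOTOMY — the cell's descent-lens gen-3
# THEOREM-GRADE statements, filed as obligation nodes (`@[conjecture] def`: typed ≠ proved)

HONEST FRAMING (cell `bsd-f3-mu`, D-0131 (3) FRONTIER TIER, HOME `run/shared/lean/pub/bsd-f3-mu/`).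
TYPER's filing of the `-desc` lens's generation-3 statements (MEMO-desc §11 «THE FINE MORDELL–WEIL
CERTIFICATE», `HOME/desc/Sketch4.lean` sha16 e481a5934f0b7626, rc 0, BC7 4/4 CLEAN `desc/Probe4.verdicts.txt`).
STATUS: THEOREM-GRADE ON PAPER (MEMO-desc §11.2 steps (1)–(8); refuter `-ref2` g5 (REF2-LITMAP M23 / §3
row desc-FMW): the HYPOTHESIS SET is printed — Ray–Sujatha, Res. Number Theory 9 (2023) Cor. 2.7 =
Wuthrich, J. Algebraic Geom. 16 (2007), conclusion there «`μ = λ = 0`, `R(E/ℚ_∞)` finite»; the sharpening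
«indeed `Sel₀(ℚ_∞, E[p^∞]) = 0`» by heights-free exact control is PRINT-ASSEMBLED (Greenberg, LNM 1716
§3 p. 88: `ker r_v` of order `c_v^{(p)}`, `= 0` at non-split `v` for odd `p`; Prop. 3.8 (p. 95) + Nakayama; Lim, Doc.
Math. 25 (2020) Thm. 3.3 / Cor. 3.5; Kundu–Lim 2022 Thm. 5.1), the exact-order fine control not printed
as a lemma, steps re-derived and found correct; refuter `-ref1` g4 sixth pass REF1-AUDIT §3.7: δ/ε/FMW
THEOREM-GRADE, statements faithful).  LEAN STATUS (2026-08-27T20:00Z): the CONTROL THEOREM IS IN THE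
TREE, in binder («rank-one anchor data») spelling and for EVERY `ℤ_p`-extension — `Summit.BirchSwinnertonDyer.
BirchSwinnertonDyer.Theorems.FineSelmerControl.fineSelmerInfty_eq_bot_of_rankOne` (`Sel₀(K_∞, E[p^∞]) = ⊥`
from: a finite set `S ∋ v₀ ∣ p` of places off which `E` is good, `#Ш(E/K)[p^∞] = 1`, `E(K) = ℤ·P ⊕ T` with
`m·T = 0`, `p ∤ m`, NO `D_{v₀}`-fixed geometric `p`-th root of `P`, and torsion sockets `E[p^∞]^{D_v}[p] = 0`
for `v ∈ S`), with `…FineSelmerControl.conjA_rat_of_rankOne` ((A) for every cyclotomic `κ`) and the cell's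
packaging `Rank1Residual.RankOneAnchorDataAt` (p556419) / `SmallImageMu.conjAAt_of_rankOneAnchorData`,
`…katoDivisibilityAt_of_rankOneAnchorData(Tam)` (p560361, `OneSidedTwistSqueezeX9FMWRung.lean`).  What is
NOT yet kernel — and the only reason these nodes stay `@[conjecture]` (typed ≠ proved) — is the DICTIONARY
from the certificate predicates to that binder data: (b1) `Ш[p] = 0 ⟹ #Ш[p^∞] = 1` — DONE
(`Rank1Residual.natCard_primaryComponent_sha_eq_one_of_shaPTorsionFreeAt`, `Rank1Residual/HeightLValueMatch.lean`);
(b2) `p ∤ ∏_v c_v` (`TamagawaCleanAt`) ⟹ the torsion sockets at the bad `v` (Greenberg §3 p. 88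
`|ker r_v| = c_v^{(p)}`; cf. `SmallImageMu.localTowerKerPrimary_zero_eq_bot_of_padicValNat_localTamagawaNumber_eq_zero`)
— per-place bookkeeping, cheap; (b3) `rank E(ℚ) = 1` ∧ `E[p]` irreducible (so `E(ℚ)[p] = 0`) ⟹
`E(ℚ) = ℤ·P ⊕ T` with `p ∤ #T` — Mordell–Weil bookkeeping, medium; (b4) `CleanAtP` / `LocallyIndivisibleAt`
(stated with `ℚ_p`-rational points of `E`) ⟹ the `D_p`-fixed GEOMETRIC socket / indivisibility — the
local-points dictionary `E(ℚ̄)^{D_p} ↔ E(ℚ̄ ∩ ℚ_p)`, the one HARD step.  Filed as `@[conjecture]` obligation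
nodes in the cell's sense «typed, to be proved» (as `FirstLayerRankCriterion` / `FirstLayerCapitulationCriterion`,
same directory), so that lines can name them as stubs and the per-pair glue
(`Literature/…/Rank1Residual/FineMordellWeilCertificates.lean` §2, `Rank1Residual.katoDivisibilityAt_of_fineMordellWeilCert`)
can consume them BY NAME; a pure CONJECTURE LEAF (no theorem here; edges in `FineMordellWeilCriteriaEdges.lean`).

MECHANISM (MEMO-desc §11.2, paper).  `p` odd, `E[p]` irreducible ⟹ `E(ℚ_∞)[p^∞] = 0` ⟹
`H¹(ℚ_Σ/ℚ, A) ≅ H¹(ℚ_Σ/ℚ_∞, A)^Γ`, `A = E[p^∞]`; the local kernels `ker(H¹(ℚ_v, A) → H¹(ℚ_{∞,w}, A)) =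
H¹(Γ_w, E(ℚ_{∞,w})[p^∞])` vanish for `v = p` (`E(ℚ_p)[p] = 0`, pro-`p` tower) and for bad `v` iff
`p ∤ c_v`; hence `Sel₀(ℚ_∞, A)^Γ ≅ Sel₀(ℚ, A) = ker(Sel_{p^∞}(E/ℚ) → E(ℚ_p) ⊗ ℚ_p/ℤ_p)`; at rank one with
`Ш[p] = 0`, `Sel_{p^∞}(E/ℚ) = E(ℚ) ⊗ ℚ_p/ℤ_p ≅ (ℚ_p/ℤ_p)·P₀` and the kernel is `ℤ/p^e`, `e` = the
`p`-divisibility of `P₀` in `E(ℚ_p)/tors`; `e = 0` iff local indivisibility; a discrete `p`-primary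
`Γ`-module with zero `Γ`-invariants is zero.  CENSUS (BC5, `HOME/desc/d10/FMW-CERT-v2.tsv` sha16
9ca5fa31d4fdb843; X9 rank-1 pairs 415 = 68 (5Ns) + 20 (7Ns) + 327 (5S4)): hypothesis rows (`E(ℚ_p)[p] = 0`,
`p ∤ ∏c_ℓ`, `Ш[p] = 0` of record) 272; CERTIFIED (`Sel₀(ℚ_∞) = 0`, hence (A) and the crux `k ≤ 0` at
the pair through T0 + S-W⁺) 234 = 24 (5Ns) + 200 (5S4) + 10 (7Ns); local indivisibility FAILS (so, by
the dichotomy, `Sel₀(ℚ_∞) ≠ 0`, finite of order `p^e`) at 38 (all `p = 5`; `e = 1`: 35, `e = 2`: 3);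
undecided 143.  Smallest certified pairs: 648a1 `p = 5` (5S4), 9225a1 `p = 7` (7Ns), 10944cc1 `p = 5`
(5Ns); canary 37a1 ↦ `p = 179` (Wuthrich 2007 §7).  Cell data table of record: `HOME/X9-MU-TABLE-v1.tsv`
sha16 361f587418fce70d (`μ_an > 0` on 0/834 valued X9 rows).

References: [RaySujatha2021] Thm. 2.5, Thm. 2.6, Cor. 2.7, Prop. 2.9, §4; [Wuthrich2007JAG]; tree
`Summits/BirchSwinnertonDyer/BirchSwinnertonDyer/Theorems/KatoDescentPotSupersingularFineSelmerControl{RankOne,FineMordellWeil}.lean`;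
[GreenbergLNM1716] §3–4; [CoatesSujatha2005] §3; [Kato2004Asterisque] §17.13; HOME MEMO-desc.md §11,
desc/Sketch4.lean, desc/d10/FMW-CERT-v2.tsv, REF2-LITMAP.md M23, CANDIDATES.md §1 row 17.
-/

-- the summit and its single problem are both named `BirchSwinnertonDyer` (registry layout D-0017)
set_option linter.dupNamespace false

noncomputable section

open scoped Classical

open WeierstrassCurve Literature.NumberTheory.EllipticCurves Literature.NumberTheory.IwasawaTheory
  Summit.BirchSwinnertonDyer.BirchSwinnertonDyer.Rank1Residual
open Literature.NumberTheory.EllipticCurves.Rank1Residual (CleanAtP TamagawaCleanAt ShaPTorsionFreeAt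
  LocallyIndivisibleAt FineMordellWeilCertAt FineSelmerTrivialAt)

namespace Summit.BirchSwinnertonDyer.Rank1Residual.SmallImageMu

/-- **FMW — FINE MORDELL–WEIL CRITERION, rank one (theorem-grade; proved in the tree in anchor-data binder
spelling, `FineSelmerControl.fineSelmerInfty_eq_bot_of_rankOne`; open HERE only modulo the certificate
dictionary (b2)–(b4) of the module docstring; nothing asserted).**  For `p` odd and `E[p]` irreducible: the fine Mordell–Weil certificate at the
pair (`Rank1Residual.FineMordellWeilCertAt`: `E(ℚ_p)[p] = 0` ∧ `p ∤ ∏ c_v` ∧ `Ш(E/ℚ)[p] = 0` ∧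
`rank E(ℚ) = 1` ∧ local indivisibility at `p`) implies `Sel₀(ℚ_∞, E[p^∞]) = 0` for every cyclotomic
`ℤ_p`-extension datum (`Rank1Residual.FineSelmerTrivialAt`).  The hypothesis set is Ray–Sujatha Cor. 2.7's
(printed conclusion `μ = λ = 0`); the conclusion `Sel₀(ℚ_∞) = 0` is the cell's sharpening by exact
control.  Verbatim the audited `HOME/desc/Sketch4.lean` §2.
[cite: RaySujatha2021, Cor. 2.7 (arXiv:2112.13335 p. 6) — the printed hypothesis set with conclusion `μ = λ = 0`; the sharpening to `Sel₀(ℚ_∞) = 0` is the cell's claim, print-assembled, not in print as stated]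
[cite: GreenbergLNM1716, §3 p. 88 (`|ker r_v| = c_v^{(p)}`) and Prop. 3.8 (p. 95) — the classical control skeleton] -/
@[conjecture] def FineMordellWeilCriterion : Prop :=
  ∀ (W : WeierstrassCurve ℚ) [W.IsElliptic] (p : ℕ) [Fact p.Prime], p ≠ 2 →
    W.HasIrreducibleModPGaloisRep p → FineMordellWeilCertAt W p → FineSelmerTrivialAt W p

/-- **Rank-zero companion (inside the known regime, recorded for completeness; theorem-grade; in the tree
in classical-Selmer spelling as `FineSelmerControl.fineSelmerInfty_eq_bot_of_natCard_selmerGroupPInfty_eq_one`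
and `FineSelmerControl.fineSelmerInfty_eq_bot_of_fineMordellWeil`, open HERE only modulo the certificate
dictionary; nothing asserted).**  For `p` odd and `E[p]` irreducible: `E(ℚ_p)[p] = 0` ∧
`p ∤ ∏ c_v` ∧ `Ш(E/ℚ)[p] = 0` ∧ `rank E(ℚ) = 0` ⟹ `Sel₀(ℚ_∞, E[p^∞]) = 0` (then already `Sel_{p^∞}(E/ℚ)`
is finite of order prime to `p`; the same control with an empty Mordell–Weil term).  Verbatim Sketch4 §2.
[cite: RaySujatha2021, Cor. 2.7 at rank `0` and Prop. 2.9 (arXiv:2112.13335 pp. 6–7) — printed with conclusion `μ = λ = 0`]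
[cite: GreenbergLNM1716, Prop. 3.8 (p. 95: good ordinary non-anomalous `p`, `p ∤ c_ℓ` for `ℓ ≠ p`, `Sel_E(ℚ)_p = 0 ⟹ Sel_E(ℚ_∞)_p = 0`) — the classical case it parallels] -/
@[conjecture] def RankZeroFineCriterion : Prop :=
  ∀ (W : WeierstrassCurve ℚ) [W.IsElliptic] (p : ℕ) [Fact p.Prime], p ≠ 2 →
    W.HasIrreducibleModPGaloisRep p → CleanAtP W p → TamagawaCleanAt W p → ShaPTorsionFreeAt W p →
    W.mordellWeilRank = 0 → FineSelmerTrivialAt W p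

/-- **DICHOTOMY on Tamagawa-clean rank-one pairs with `E(ℚ_p)[p] = 0` and `Ш[p] = 0` (theorem-grade on
paper, MEMO-desc §11.2; the «⟸» direction is in the tree in anchor-data spelling
(`FineSelmerControl.fineSelmerInfty_eq_bot_of_rankOne`), the «⟹» direction (`Sel₀(ℚ_∞)^Γ ≅ ℤ/p^e ≠ 0`
when local indivisibility fails) is not; nothing asserted).**  For `p` odd and `E[p]` irreducible, under
`E(ℚ_p)[p] = 0`, `p ∤ ∏ c_v`, `Ш(E/ℚ)[p] = 0`, `rank E(ℚ) = 1`: `Sel₀(ℚ_∞, E[p^∞]) = 0` IFF local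
indivisibility at `p` (otherwise `Sel₀(ℚ_∞, E[p^∞])^Γ ≅ ℤ/p^e ≠ 0`, the fine Mordell–Weil group —
Wuthrich's example 37a1 at `p = 179`; 38 rank-1 X9 rows of the census, all at `p = 5`).  Implies the FMW
criterion (edges file).  Verbatim Sketch4 §2.
[cite: RaySujatha2021, Thm. 2.6 (Wuthrich's leading term `a_0 ∼ #Tors_{ℤ_p}(D)·∏c_ℓ·#Ж/#J` at rank ≤ 1) and §4 Lemma 4.7 (arXiv:2112.13335 pp. 6, 12) — the printed source of both directions up to finiteness; the exact `Sel₀ = 0 ⟺` form is the cell's claim] -/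
@[conjecture] def FineMordellWeilDichotomy : Prop :=
  ∀ (W : WeierstrassCurve ℚ) [W.IsElliptic] (p : ℕ) [Fact p.Prime], p ≠ 2 →
    W.HasIrreducibleModPGaloisRep p → CleanAtP W p → TamagawaCleanAt W p → ShaPTorsionFreeAt W p →
    W.mordellWeilRank = 1 → (FineSelmerTrivialAt W p ↔ LocallyIndivisibleAt W p)

end Summit.BirchSwinnertonDyer.Rank1Residual.SmallImageMu

end
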